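import Summits.NavierStokesRegularity.NavierStokesRegularity.Theorems.FilamentSkeletonRssSkeletonJ1RSingularBranchUnique

/-!
# Route `FilamentSkeletonRss` · crux `SkeletonJ1R` (stmt-NavierStokesRegularity-23610) · registered line `streamline_kantorovich_R`
# — brick K-§3g for stub K `KantorovichClosingL`: CONTINUOUS DEPENDENCE of the nonlinear regular branch on the data `(K₀, H)`

Hand `ns-filament-21221-p1` (g18), `--supports stmt-NavierStokesRegularity-23610 --as helper`; pure Mathlib + the landed K-§3 bricks.

WHY.  K-notes §1(c)/§2 of the lead need the dependence of the unstable streamline `Φ¹(Y)` on the skeleton `Y`.  In the parameterization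
currency (`P = p + s q(s)`, branch equation `s q′ = K q + s H(s, q)`), after K's own normalisation of the waist zero, the eigenvalue and the
eigenvector (`p ↦ 0`, `λ ↦ 1`, `ξ ↦ ξ₀`), what varies with `Y` is the pair `(K, H)`.  THIS FILE is the `C⁰` step (D0):
`singularBranch_dist_le` — if `q₁` solves the branch equation for `(K₁, H₁)` and `q₂` for `(K₂, H₂)` on `(0, δ)` (both in `B̄(ξ, R)`, both
`→ ξ` at `0⁺`, `q₂` with the linear bound `‖q₂(x) − ξ‖ ≤ C₁ x` of `exists_singularBranch`), with `K₁ ∘ Π = K₁`, `Π ξ = 0`, bounded forward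
semigroup of `K₁` on range `Π`, `K₂ ξ = 0`, `‖K₂ − K₁‖ ≤ κ`, `H₁` `L`-Lipschitz in `q`, and `‖H₁(s, q) − H₂(s, q)‖ ≤ η` on `(0, δ] × B̄(ξ, R)`,
then `‖q₁(x) − q₂(x)‖ ≤ C₂ (η + κ C₁) δ · e^{C₂ L x}` on `(0, δ)` (`C₂ = max C 0·‖Π‖ + 1 + ‖Π‖`).  PROOF: the variation-of-constants
argument of `singularBranch_unique` with the extra source `x(H₁(x,q₂) − H₂(x,q₂)) − (K₂ − K₁) q₂(x)` of size `≤ (η + κ C₁) x` (because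
`(K₂ − K₁) ξ = 0`), then Grönwall with a constant (`le_mul_exp_of_le_add_integral`).  The `C¹` dependence (D1, fiber contraction) is NOT here.

HONEST FRAMING.  A generic ODE lemma, sub-brick of the OPEN stub K; stub K, the crux 23610 and its heart stay OPEN; MODEL rung, ∃-side of a
HYPOTHETICAL filament-type rotating-self-similar blow-up skeleton; nothing here is a claim about Navier–Stokes regularity or blow-up.
References: Coddington–Levinson (1955) Ch. 1 §7 (continuous dependence), Ch. 13 §4; Hartman (2002) Ch. III §4 (Grönwall).
-/

set_option linter.dupNamespace false -- `NavierStokesRegularity.NavierStokesRegularity` path/namespace repetition is the tree convention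

noncomputable section

namespace Summit.NavierStokesRegularity.NavierStokesRegularity.Theorems.SkeletonJ1RUnstableCurve

open Set Function Filter MeasureTheory intervalIntegral Metric NormedSpace
open scoped Topology

variable {E : Type*} [NormedAddCommGroup E] [NormedSpace ℝ E] [CompleteSpace E]

/-! ## §1 Grönwall with a constant, from the singular end -/

omit [NormedSpace ℝ E] [CompleteSpace E] in
/-- **Grönwall from the singular end, inhomogeneous.** If `n : ℝ → ℝ` is nonnegative, continuous and bounded on `(0, δ)`, and
`n(x) ≤ A + K ∫₀ˣ n` on `(0, δ)` with `K ≥ 0`, then `n(x) ≤ A e^{Kx}` on `(0, δ)` (`x ↦ e^{−Kx}(K∫₀ˣ n + A)` is non-increasing). [folklore] -/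
theorem le_mul_exp_of_le_add_integral {n : ℝ → ℝ} {δ K A B : ℝ} (hK : 0 ≤ K) (hn : ContinuousOn n (Ioo 0 δ))
    (hn0 : ∀ x, 0 ≤ n x) (hnB : ∀ x ∈ Ioo 0 δ, n x ≤ B)
    (hle : ∀ x ∈ Ioo 0 δ, n x ≤ A + K * ∫ s in (0 : ℝ)..x, n s) : ∀ x ∈ Ioo 0 δ, n x ≤ A * Real.exp (K * x) := by
  have hB : ∀ x ∈ Ioo 0 δ, ‖n x‖ ≤ |B| := fun x hx => by
    rw [Real.norm_eq_abs, abs_of_nonneg (hn0 x)]; exact (hnB x hx).trans (le_abs_self B)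
  have hint : ∀ y ∈ Ico 0 δ, IntervalIntegrable n volume 0 y := fun y hy =>
    intervalIntegrable_of_continuousOn_Ioc (E := ℝ) hy.1 (hn.mono fun s hs => ⟨hs.1, lt_of_le_of_lt hs.2 hy.2⟩)
      fun s hs => hB s ⟨hs.1, lt_of_le_of_lt hs.2 hy.2⟩
  set N : ℝ → ℝ := fun x => ∫ s in (0 : ℝ)..x, n s with hN
  have hN0 : N 0 = 0 := by simp [hN]
  have hNb : ∀ x ∈ Ico 0 δ, ‖N x‖ ≤ |B| * x := fun x hx =>
    norm_integral_le_of_le_on_Ioc (E := ℝ) hx.1 fun s hs => hB s ⟨hs.1, lt_of_le_of_lt hs.2 hx.2⟩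
  have hNd : ∀ x ∈ Ioo 0 δ, HasDerivAt N (n x) x := fun x hx =>
    intervalIntegral.integral_hasDerivAt_right (hint x ⟨hx.1.le, hx.2⟩)
      (hn.stronglyMeasurableAtFilter isOpen_Ioo x hx) (hn.continuousAt (Ioo_mem_nhds hx.1 hx.2))
  -- `h(x) = e^{−Kx}(K N(x) + A)` is non-increasing on `[0, δ)`
  set h : ℝ → ℝ := fun x => Real.exp (-(K * x)) * (K * N x + A) with hh
  have hhd : ∀ x ∈ Ioo 0 δ, HasDerivAt h (Real.exp (-(K * x)) * (K * (n x - K * N x - A))) x := by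
    intro x hx
    have he : HasDerivAt (fun y => Real.exp (-(K * y))) (Real.exp (-(K * x)) * (-K)) x := by
      simpa using (((hasDerivAt_id x).const_mul K).neg).exp
    have h := he.mul (((hNd x hx).const_mul K).add_const A)
    refine h.congr_deriv ?_
    ring
  have hhc : ContinuousOn h (Ico 0 δ) := by
    intro x hx
    rcases hx.1.eq_or_lt with rfl | hx0
    · have hNc : ContinuousWithinAt N (Ico 0 δ) 0 := by
        rw [Metric.continuousWithinAt_iff]
        intro ε hε
        refine ⟨ε / (|B| + 1), by positivity, fun y hy hyd => ?_⟩
        rw [dist_eq_norm, hN0, sub_zero]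
        rw [dist_zero_right, Real.norm_eq_abs, abs_of_nonneg hy.1] at hyd
        calc ‖N y‖ ≤ |B| * y := hNb y hy
          _ ≤ (|B| + 1) * y := by nlinarith [hy.1, abs_nonneg B]
          _ < (|B| + 1) * (ε / (|B| + 1)) := mul_lt_mul_of_pos_left hyd (by positivity)
          _ = ε := by field_simp
      exact ((Real.continuous_exp.comp (continuous_const.mul continuous_id).neg).continuousWithinAt).mul
        ((hNc.const_smul K).add continuousWithinAt_const)
    · exact (hhd x ⟨hx0, hx.2⟩).continuousAt.continuousWithinAt
  have hanti : AntitoneOn h (Ico 0 δ) := by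
    refine antitoneOn_of_deriv_nonpos (convex_Ico 0 δ) hhc ?_ ?_
    · rw [interior_Ico]
      exact fun x hx => (hhd x hx).differentiableAt.differentiableWithinAt
    · rw [interior_Ico]
      intro x hx
      rw [(hhd x hx).deriv]
      have h1 : n x - K * N x - A ≤ 0 := by linarith [hle x hx]
      exact mul_nonpos_of_nonneg_of_nonpos (Real.exp_nonneg _) (mul_nonpos_of_nonneg_of_nonpos hK h1)
  intro x hx
  have hhx : h x ≤ h 0 := hanti ⟨le_rfl, hx.1.trans hx.2⟩ ⟨hx.1.le, hx.2⟩ hx.1.le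
  have hh0 : h 0 = A := by simp [hh, hN0]
  rw [hh0] at hhx
  -- `e^{−Kx}(K N x + A) ≤ A` ⇒ `K N x + A ≤ A e^{Kx}` ⇒ `n x ≤ A e^{Kx}`
  have he : 0 < Real.exp (-(K * x)) := Real.exp_pos _
  have hmul : K * N x + A ≤ A * Real.exp (K * x) := by
    have h1 : Real.exp (-(K * x)) * (K * N x + A) ≤ A := hhx
    have h2 : Real.exp (K * x) * (Real.exp (-(K * x)) * (K * N x + A)) ≤ Real.exp (K * x) * A :=
      mul_le_mul_of_nonneg_left h1 (Real.exp_nonneg _)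
    have h3 : Real.exp (K * x) * Real.exp (-(K * x)) = 1 := by rw [← Real.exp_add, add_neg_cancel, Real.exp_zero]
    calc K * N x + A = (Real.exp (K * x) * Real.exp (-(K * x))) * (K * N x + A) := by rw [h3, one_mul]
      _ = Real.exp (K * x) * (Real.exp (-(K * x)) * (K * N x + A)) := by ring
      _ ≤ Real.exp (K * x) * A := h2
      _ = A * Real.exp (K * x) := by ring
  have h1 := hle x hx
  simp only [hN] at hmul
  linarith

/-! ## §2 Continuous dependence of the regular branch on `(K, H)` -/

/-- **CONTINUOUS DEPENDENCE OF THE NONLINEAR REGULAR BRANCH.**  Let `K₁ ∘ Π = K₁`, `Π ξ = 0`, `‖exp(tK₁) Π v‖ ≤ C‖Π v‖` (`t ≥ 0`),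
`K₂ ξ = 0`, `‖K₂ − K₁‖ ≤ κ`; let `H₁, H₂` be continuous on `(0, δ₀] × B̄(ξ, R)`, `H₁` `L`-Lipschitz in `q` there, and
`‖H₁(s, q) − H₂(s, q)‖ ≤ η` there.  If `qᵢ` solves `x qᵢ′ = Kᵢ qᵢ + x Hᵢ(x, qᵢ)` on `(0, δ)` (`δ ≤ δ₀`) with values in `B̄(ξ, R)`, `qᵢ → ξ` at
`0⁺`, and `‖q₂(x) − ξ‖ ≤ C₁ x`, then `‖q₁(x) − q₂(x)‖ ≤ C₂ (η + κ C₁) δ · e^{C₂ L x}` on `(0, δ)`, `C₂ = max C 0·‖Π‖ + 1 + ‖Π‖`.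
[cite: CoddingtonLevinson1955, Ch. 1 §7 Thm 7.1 (continuous dependence); singular-end form] -/
theorem singularBranch_dist_le {K₁ K₂ Pr : E →L[ℝ] E} {H₁ H₂ : ℝ → E → E} {ξ : E} {δ₀ δ C C₁ L R η κ : ℝ}
    {q₁ q₂ q₁' q₂' : ℝ → E}
    (hδle : δ ≤ δ₀) (hL : 0 ≤ L) (hC₁ : 0 ≤ C₁) (hη : 0 ≤ η) (hκ : 0 ≤ κ)
    (hK₁Pr : ∀ v, K₁ (Pr v) = K₁ v) (hPrξ : Pr ξ = 0)
    (hbound : ∀ t : ℝ, 0 ≤ t → ∀ v : E, ‖exp (t • K₁) (Pr v)‖ ≤ C * ‖Pr v‖)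
    (hK₂ξ : K₂ ξ = 0) (hK : ‖K₂ - K₁‖ ≤ κ)
    (hH₁c : ContinuousOn (uncurry H₁) (Ioc 0 δ₀ ×ˢ closedBall ξ R))
    (hH₂c : ContinuousOn (uncurry H₂) (Ioc 0 δ₀ ×ˢ closedBall ξ R))
    (hH₁L : ∀ s ∈ Ioc 0 δ₀, ∀ q ∈ closedBall ξ R, ∀ q' ∈ closedBall ξ R, ‖H₁ s q - H₁ s q'‖ ≤ L * ‖q - q'‖)
    (hH₁₂ : ∀ s ∈ Ioc 0 δ₀, ∀ q ∈ closedBall ξ R, ‖H₁ s q - H₂ s q‖ ≤ η)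
    (h₁d : ∀ x ∈ Ioo 0 δ, HasDerivAt q₁ (q₁' x) x) (h₂d : ∀ x ∈ Ioo 0 δ, HasDerivAt q₂ (q₂' x) x)
    (h₁e : ∀ x ∈ Ioo 0 δ, x • q₁' x = K₁ (q₁ x) + x • H₁ x (q₁ x))
    (h₂e : ∀ x ∈ Ioo 0 δ, x • q₂' x = K₂ (q₂ x) + x • H₂ x (q₂ x))
    (h₁R : ∀ x ∈ Ioo 0 δ, ‖q₁ x - ξ‖ ≤ R) (h₂R : ∀ x ∈ Ioo 0 δ, ‖q₂ x - ξ‖ ≤ R)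
    (h₂lin : ∀ x ∈ Ioo 0 δ, ‖q₂ x - ξ‖ ≤ C₁ * x)
    (h₁0 : Tendsto q₁ (𝓝[>] 0) (𝓝 ξ)) (h₂0 : Tendsto q₂ (𝓝[>] 0) (𝓝 ξ)) :
    ∀ x ∈ Ioo 0 δ, ‖q₁ x - q₂ x‖ ≤
      (max C 0 * ‖Pr‖ + 1 + ‖Pr‖) * (η + κ * C₁) * δ * Real.exp ((max C 0 * ‖Pr‖ + 1 + ‖Pr‖) * L * x) := by
  set C₂ : ℝ := max C 0 * ‖Pr‖ + 1 + ‖Pr‖ with hC₂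
  have hC₂0 : 0 ≤ C₂ := by positivity
  have hsg : ∀ {t : ℝ}, 0 ≤ t → ∀ w : E, ‖exp (t • K₁) w‖ ≤ C₂ * ‖w‖ := fun ht w =>
    norm_exp_smul_apply_le_of_range hK₁Pr hbound ht w
  have hK₁ξ : K₁ ξ = 0 := by rw [← hK₁Pr, hPrξ, map_zero]
  set d : ℝ → E := fun x => q₁ x - q₂ x with hd
  -- the source: `Δ = H₁(q₁) − H₂(q₂) − x⁻¹ (K₂ − K₁) q₂`
  set Δ : ℝ → E := fun x => (H₁ x (q₁ x) - H₂ x (q₂ x)) - x⁻¹ • ((K₂ - K₁) (q₂ x)) with hΔ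
  -- continuity on `(0, δ)`
  have hmem : ∀ {i : ℝ → E}, (∀ x ∈ Ioo 0 δ, ‖i x - ξ‖ ≤ R) → ∀ x ∈ Ioo 0 δ, i x ∈ closedBall ξ R :=
    fun hi x hx => mem_closedBall.2 (by rw [dist_eq_norm]; exact hi x hx)
  have hq₁c : ContinuousOn q₁ (Ioo 0 δ) := fun x hx => (h₁d x hx).continuousAt.continuousWithinAt
  have hq₂c : ContinuousOn q₂ (Ioo 0 δ) := fun x hx => (h₂d x hx).continuousAt.continuousWithinAt
  have hHic : ∀ {Hi : ℝ → E → E} {i : ℝ → E}, ContinuousOn (uncurry Hi) (Ioc 0 δ₀ ×ˢ closedBall ξ R) →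
      ContinuousOn i (Ioo 0 δ) → (∀ x ∈ Ioo 0 δ, ‖i x - ξ‖ ≤ R) → ContinuousOn (fun x => Hi x (i x)) (Ioo 0 δ) := by
    intro Hi i hHc hic hiR
    have hmaps : MapsTo (fun x => (x, i x)) (Ioo 0 δ) (Ioc 0 δ₀ ×ˢ closedBall ξ R) := fun x hx =>
      ⟨⟨hx.1, hx.2.le.trans hδle⟩, hmem hiR x hx⟩
    exact hHc.comp (continuousOn_id.prodMk hic) hmaps
  have hdc : ContinuousOn d (Ioo 0 δ) := hq₁c.sub hq₂c
  have hΔc : ContinuousOn Δ (Ioo 0 δ) := by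
    refine ((hHic hH₁c hq₁c h₁R).sub (hHic hH₂c hq₂c h₂R)).sub ?_
    have hinv : ContinuousOn (fun x : ℝ => x⁻¹) (Ioo 0 δ) :=
      continuousOn_inv₀.mono fun x hx => (ne_of_gt hx.1 : x ≠ 0)
    exact hinv.smul ((K₂ - K₁).continuous.comp_continuousOn hq₂c)
  -- the source bound `‖Δ x‖ ≤ L ‖d x‖ + (η + κ C₁)`
  have hΔL : ∀ x ∈ Ioo 0 δ, ‖Δ x‖ ≤ L * ‖d x‖ + (η + κ * C₁) := by
    intro x hx
    have hxI : x ∈ Ioc 0 δ₀ := ⟨hx.1, hx.2.le.trans hδle⟩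
    have e : H₁ x (q₁ x) - H₂ x (q₂ x) = (H₁ x (q₁ x) - H₁ x (q₂ x)) + (H₁ x (q₂ x) - H₂ x (q₂ x)) := by abel
    have h1 : ‖H₁ x (q₁ x) - H₁ x (q₂ x)‖ ≤ L * ‖d x‖ := hH₁L x hxI _ (hmem h₁R x hx) _ (hmem h₂R x hx)
    have h2 : ‖H₁ x (q₂ x) - H₂ x (q₂ x)‖ ≤ η := hH₁₂ x hxI _ (hmem h₂R x hx)
    -- `(K₂ − K₁) q₂ = (K₂ − K₁)(q₂ − ξ)` since both kill `ξ`
    have hKq : (K₂ - K₁) (q₂ x) = (K₂ - K₁) (q₂ x - ξ) := by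
      rw [map_sub (K₂ - K₁) (q₂ x) ξ]
      have : (K₂ - K₁) ξ = 0 := by
        show K₂ ξ - K₁ ξ = 0
        rw [hK₂ξ, hK₁ξ, sub_zero]
      rw [this, sub_zero]
    have h3 : ‖x⁻¹ • ((K₂ - K₁) (q₂ x))‖ ≤ κ * C₁ := by
      have hx0 : x ≠ 0 := hx.1.ne'
      rw [hKq, norm_smul, norm_inv, Real.norm_eq_abs, abs_of_pos hx.1]
      calc x⁻¹ * ‖(K₂ - K₁) (q₂ x - ξ)‖ ≤ x⁻¹ * (‖K₂ - K₁‖ * ‖q₂ x - ξ‖) :=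
            mul_le_mul_of_nonneg_left ((K₂ - K₁).le_opNorm _) (inv_nonneg.2 hx.1.le)
        _ ≤ x⁻¹ * (κ * (C₁ * x)) := mul_le_mul_of_nonneg_left
            (mul_le_mul hK (h₂lin x hx) (norm_nonneg _) hκ) (inv_nonneg.2 hx.1.le)
        _ = κ * C₁ := by field_simp
    calc ‖Δ x‖ ≤ ‖H₁ x (q₁ x) - H₂ x (q₂ x)‖ + ‖x⁻¹ • ((K₂ - K₁) (q₂ x))‖ := norm_sub_le _ _
      _ ≤ (‖H₁ x (q₁ x) - H₁ x (q₂ x)‖ + ‖H₁ x (q₂ x) - H₂ x (q₂ x)‖) + κ * C₁ := by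
          rw [e]; exact add_le_add (norm_add_le _ _) h3
      _ ≤ L * ‖d x‖ + (η + κ * C₁) := by linarith
  have hd0 : Tendsto (fun x => ‖d x‖) (𝓝[>] 0) (𝓝 0) := by
    have h := (h₁0.sub h₂0).norm
    simpa [hd] using h
  -- the equation for `d`: `x d′ = K₁ d + x Δ`
  have hde : ∀ s ∈ Ioo 0 δ, q₁' s - q₂' s = s⁻¹ • K₁ (d s) + Δ s := by
    intro s hs
    have hs0 : s ≠ 0 := hs.1.ne'
    have e1 : q₁' s = s⁻¹ • (K₁ (q₁ s) + s • H₁ s (q₁ s)) := by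
      rw [← h₁e s hs, smul_smul, inv_mul_cancel₀ hs0, one_smul]
    have e2 : q₂' s = s⁻¹ • (K₂ (q₂ s) + s • H₂ s (q₂ s)) := by
      rw [← h₂e s hs, smul_smul, inv_mul_cancel₀ hs0, one_smul]
    have e3 : K₂ (q₂ s) = K₁ (q₂ s) + (K₂ - K₁) (q₂ s) := by
      show K₂ (q₂ s) = K₁ (q₂ s) + (K₂ (q₂ s) - K₁ (q₂ s)); abel
    rw [e1, e2, e3]
    simp only [hd, hΔ, map_sub, smul_add, smul_sub, smul_smul, inv_mul_cancel₀ hs0, one_smul]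
    abel
  -- the key estimate: variation of constants on `[x, x₀]`
  have hkey : ∀ x x₀ : ℝ, 0 < x → x ≤ x₀ → x₀ < δ →
      ‖d x₀‖ ≤ C₂ * ‖d x‖ + (C₂ * L * ∫ s in x..x₀, ‖d s‖) + C₂ * (η + κ * C₁) * (x₀ - x) := by
    intro x x₀ hx hxx₀ hx₀
    set a : ℝ := Real.log x₀ with ha
    set c : ℝ → E →L[ℝ] E := fun s => exp ((a - Real.log s) • K₁) with hc
    have hIoo : ∀ {s}, s ∈ Icc x x₀ → s ∈ Ioo 0 δ := fun hs => ⟨lt_of_lt_of_le hx hs.1, lt_of_le_of_lt hs.2 hx₀⟩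
    have hψd : ∀ s ∈ Icc x x₀, HasDerivAt (fun σ => c σ (d σ)) (c s (Δ s)) s := by
      intro s hs
      have hs0 : 0 < s := lt_of_lt_of_le hx hs.1
      have hsI := hIoo hs
      have hcd : HasDerivAt c ((-s⁻¹) • (K₁ * c s)) s := hasDerivAt_exp_sub_log_smul K₁ a hs0
      have hdd : HasDerivAt d (q₁' s - q₂' s) s := (h₁d s hsI).sub (h₂d s hsI)
      have h := hcd.clm_apply hdd
      refine h.congr_deriv ?_
      have hcomm : K₁ * c s = c s * K₁ := ((Commute.refl K₁).smul_right (a - Real.log s)).exp_right.eq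
      have hcommv : ∀ v, K₁ (c s v) = c s (K₁ v) := fun v => by
        have h := congrArg (fun T : E →L[ℝ] E => T v) hcomm
        simpa using h
      have e' : ((-s⁻¹) • (K₁ * c s)) (d s) = (-s⁻¹) • K₁ (c s (d s)) := rfl
      rw [hde s hsI, map_add, map_smul, e', hcommv]
      simp only [neg_smul]
      abel
    have hgc : ContinuousOn (fun s => c s (Δ s)) (Icc x x₀) := by
      have hcc : ContinuousOn c (Icc x x₀) := by
        have h1 : ContinuousOn (fun s : ℝ => a - Real.log s) (Icc x x₀) :=
          continuousOn_const.sub (Real.continuousOn_log.mono fun s hs => (lt_of_lt_of_le hx hs.1).ne')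
        exact (continuous_exp_smul K₁).comp_continuousOn h1
      exact hcc.clm_apply (hΔc.mono fun s hs => hIoo hs)
    have hFTC := intervalIntegral.integral_eq_sub_of_hasDerivAt
      (fun s hs => hψd s (by rwa [uIcc_of_le hxx₀] at hs)) (hgc.intervalIntegrable_of_Icc hxx₀)
    have hψ₀ : c x₀ (d x₀) = d x₀ := by
      have h1 : c x₀ = 1 := by simp only [hc, ha, sub_self, zero_smul, exp_zero]
      rw [h1]; rfl
    rw [hψ₀] at hFTC
    have hdx₀ : d x₀ = c x (d x) + ∫ s in x..x₀, c s (Δ s) := by rw [hFTC]; abel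
    have hψx : ‖c x (d x)‖ ≤ C₂ * ‖d x‖ := by
      have ht : 0 ≤ a - Real.log x := by have := Real.log_le_log hx hxx₀; rw [ha]; linarith
      exact hsg ht (d x)
    have hI : ‖∫ s in x..x₀, c s (Δ s)‖ ≤ ∫ s in x..x₀, (C₂ * L * ‖d s‖ + C₂ * (η + κ * C₁)) := by
      refine intervalIntegral.norm_integral_le_of_norm_le hxx₀ ?_ ?_
      · refine Filter.Eventually.of_forall fun s hs => ?_
        have hsI : s ∈ Icc x x₀ := ⟨hs.1.le, hs.2⟩
        have ht : 0 ≤ a - Real.log s := by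
          have := Real.log_le_log (lt_of_lt_of_le hx hsI.1) hsI.2; rw [ha]; linarith
        calc ‖c s (Δ s)‖ ≤ C₂ * ‖Δ s‖ := hsg ht (Δ s)
          _ ≤ C₂ * (L * ‖d s‖ + (η + κ * C₁)) := mul_le_mul_of_nonneg_left (hΔL s (hIoo hsI)) hC₂0
          _ = C₂ * L * ‖d s‖ + C₂ * (η + κ * C₁) := by ring
      · exact (((hdc.mono fun s hs => hIoo hs).norm.intervalIntegrable_of_Icc hxx₀).const_mul _).add
          intervalIntegrable_const
    rw [intervalIntegral.integral_add (((hdc.mono fun s hs => hIoo hs).norm.intervalIntegrable_of_Icc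
        hxx₀).const_mul _) intervalIntegrable_const,
      intervalIntegral.integral_const_mul, intervalIntegral.integral_const, smul_eq_mul] at hI
    calc ‖d x₀‖ = ‖c x (d x) + ∫ s in x..x₀, c s (Δ s)‖ := by rw [← hdx₀]
      _ ≤ ‖c x (d x)‖ + ‖∫ s in x..x₀, c s (Δ s)‖ := norm_add_le _ _
      _ ≤ C₂ * ‖d x‖ + ((C₂ * L * ∫ s in x..x₀, ‖d s‖) + (x₀ - x) * (C₂ * (η + κ * C₁))) := add_le_add hψx hI
      _ = C₂ * ‖d x‖ + (C₂ * L * ∫ s in x..x₀, ‖d s‖) + C₂ * (η + κ * C₁) * (x₀ - x) := by ring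
  -- pass to the limit `x → 0⁺`
  set n : ℝ → ℝ := fun x => ‖d x‖ with hn
  have hnc : ContinuousOn n (Ioo 0 δ) := hdc.norm
  have hnB : ∀ x ∈ Ioo 0 δ, n x ≤ R + R := fun x hx => by
    calc ‖d x‖ = ‖(q₁ x - ξ) - (q₂ x - ξ)‖ := by simp only [hd]; abel_nf
      _ ≤ ‖q₁ x - ξ‖ + ‖q₂ x - ξ‖ := norm_sub_le _ _
      _ ≤ R + R := add_le_add (h₁R x hx) (h₂R x hx)
  have hnint : ∀ y ∈ Ico 0 δ, IntervalIntegrable n volume 0 y := fun y hy =>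
    intervalIntegrable_of_continuousOn_Ioc (E := ℝ) hy.1 (hnc.mono fun s hs => ⟨hs.1, lt_of_le_of_lt hs.2 hy.2⟩)
      fun s hs => by
        rw [Real.norm_eq_abs, abs_of_nonneg (norm_nonneg _)]
        exact hnB s ⟨hs.1, lt_of_le_of_lt hs.2 hy.2⟩
  set A₀ : ℝ := C₂ * (η + κ * C₁) * δ with hA₀
  have hle : ∀ x₀ ∈ Ioo 0 δ, n x₀ ≤ A₀ + C₂ * L * ∫ s in (0 : ℝ)..x₀, n s := by
    intro x₀ hx₀
    have hev : ∀ᶠ x in 𝓝[>] (0 : ℝ), n x₀ ≤ C₂ * n x + (A₀ + C₂ * L * ∫ s in (0 : ℝ)..x₀, n s) := by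
      filter_upwards [Ioo_mem_nhdsGT hx₀.1] with x hx
      have h1 := hkey x x₀ hx.1 hx.2.le hx₀.2
      have hsplit : (∫ s in (0 : ℝ)..x, n s) + ∫ s in x..x₀, n s = ∫ s in (0 : ℝ)..x₀, n s :=
        intervalIntegral.integral_add_adjacent_intervals (hnint x ⟨hx.1.le, hx.2.trans hx₀.2⟩)
          ((hnc.mono fun s hs => ⟨lt_of_lt_of_le hx.1 hs.1, lt_of_le_of_lt hs.2 hx₀.2⟩).intervalIntegrable_of_Icc
            hx.2.le)
      have hN0x : 0 ≤ ∫ s in (0 : ℝ)..x, n s := intervalIntegral.integral_nonneg_of_forall hx.1.le fun u => norm_nonneg _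
      have h2 : ∫ s in x..x₀, n s ≤ ∫ s in (0 : ℝ)..x₀, n s := by linarith
      have h3 : C₂ * L * ∫ s in x..x₀, n s ≤ C₂ * L * ∫ s in (0 : ℝ)..x₀, n s :=
        mul_le_mul_of_nonneg_left h2 (by positivity)
      have h4 : C₂ * (η + κ * C₁) * (x₀ - x) ≤ A₀ := by
        rw [hA₀]; exact mul_le_mul_of_nonneg_left (by linarith [hx.1, hx₀.2]) (by positivity)
      simp only [hn] at h1 ⊢
      linarith
    have hlim : Tendsto (fun x => C₂ * n x + (A₀ + C₂ * L * ∫ s in (0 : ℝ)..x₀, n s)) (𝓝[>] 0)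
        (𝓝 (C₂ * 0 + (A₀ + C₂ * L * ∫ s in (0 : ℝ)..x₀, n s))) :=
      (hd0.const_mul C₂).add tendsto_const_nhds
    rw [mul_zero, zero_add] at hlim
    exact ge_of_tendsto hlim hev
  have hres := le_mul_exp_of_le_add_integral (A := A₀) (B := R + R) (by positivity) hnc (fun x => norm_nonneg _) hnB hle
  intro x hx
  have h := hres x hx
  simp only [hn, hd, hA₀] at h
  calc ‖q₁ x - q₂ x‖ ≤ C₂ * (η + κ * C₁) * δ * Real.exp (C₂ * L * x) := h
    _ = C₂ * (η + κ * C₁) * δ * Real.exp (C₂ * L * x) := rfl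

/-! ## §3 Uniqueness of the unstable curve, left arm (appended 2026-08-29, same hand) -/

/-- **UNIQUENESS OF THE UNSTABLE CURVE (left arm)**: the reflection `s ↦ P(−s)`, `ξ ↦ −ξ` of `unstableCurve_unique_right`
(`…SkeletonJ1RSingularBranchUnique`).  Two solutions of `λ s P′(s) = f(P(s))` on `(−δ, 0)` in the cone `‖P(s) − p − sξ‖ ≤ R|s|` with
`s⁻¹(P(s) − p) → ξ` as `s → 0⁻` coincide on `(−δ, 0)`. [cite: CoddingtonLevinson1955, Ch. 13 §4] -/
theorem unstableCurve_unique_left {f : E → E} {f' : E → E →L[ℝ] E} {Pr : E →L[ℝ] E} {p ξ : E} {lam C ω ρ₀ R δ : ℝ}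
    {P₁ P₂ P₁' P₂' : ℝ → E}
    (hlam : 0 < lam) (hω : 0 ≤ ω) (hR : 0 ≤ R) (hδρ : δ * (‖ξ‖ + R) < ρ₀)
    (hf0 : f p = 0) (hfd : ∀ y ∈ ball p ρ₀, HasFDerivAt f (f' y) y)
    (hlip : ∀ y ∈ ball p ρ₀, ‖f' y - f' p‖ ≤ ω * ‖y - p‖)
    (hAPr : ∀ v, f' p v - f' p (Pr v) = lam • (v - Pr v))
    (hexpA : ∀ t : ℝ, 0 ≤ t → ∀ v : E, ‖exp (t • f' p) (Pr v)‖ ≤ C * Real.exp (lam * t) * ‖Pr v‖)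
    (h₁d : ∀ s ∈ Ioo (-δ) 0, HasDerivAt P₁ (P₁' s) s) (h₂d : ∀ s ∈ Ioo (-δ) 0, HasDerivAt P₂ (P₂' s) s)
    (h₁e : ∀ s ∈ Ioo (-δ) 0, (lam * s) • P₁' s = f (P₁ s)) (h₂e : ∀ s ∈ Ioo (-δ) 0, (lam * s) • P₂' s = f (P₂ s))
    (h₁c : ∀ s ∈ Ioo (-δ) 0, ‖P₁ s - p - s • ξ‖ ≤ R * |s|) (h₂c : ∀ s ∈ Ioo (-δ) 0, ‖P₂ s - p - s • ξ‖ ≤ R * |s|)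
    (h₁t : Tendsto (fun s => s⁻¹ • (P₁ s - p)) (𝓝[<] 0) (𝓝 ξ))
    (h₂t : Tendsto (fun s => s⁻¹ • (P₂ s - p)) (𝓝[<] 0) (𝓝 ξ)) :
    EqOn P₁ P₂ (Ioo (-δ) 0) := by
  -- the reflected data
  have hmem : ∀ {s : ℝ}, s ∈ Ioo 0 δ → -s ∈ Ioo (-δ) 0 := fun hs => ⟨by linarith [hs.2], by linarith [hs.1]⟩
  have hδρ' : δ * (‖-ξ‖ + R) < ρ₀ := by rwa [norm_neg]
  have hneg : Tendsto (fun s : ℝ => -s) (𝓝[>] (0 : ℝ)) (𝓝[<] (0 : ℝ)) := by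
    refine tendsto_nhdsWithin_of_tendsto_nhds_of_eventually_within _ ?_ ?_
    · simpa using ((continuous_neg (G := ℝ)).tendsto (0 : ℝ)).mono_left nhdsWithin_le_nhds
    · filter_upwards [self_mem_nhdsWithin] with s hs
      exact mem_Iio.2 (neg_lt_zero.2 (mem_Ioi.1 hs))
  have hrefl : ∀ {P P' : ℝ → E}, (∀ s ∈ Ioo (-δ) 0, HasDerivAt P (P' s) s) →
      (∀ s ∈ Ioo (-δ) 0, (lam * s) • P' s = f (P s)) → (∀ s ∈ Ioo (-δ) 0, ‖P s - p - s • ξ‖ ≤ R * |s|) →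
      Tendsto (fun s => s⁻¹ • (P s - p)) (𝓝[<] 0) (𝓝 ξ) →
      (∀ s ∈ Ioo 0 δ, HasDerivAt (fun σ => P (-σ)) (-(P' (-s))) s) ∧
      (∀ s ∈ Ioo 0 δ, (lam * s) • (-(P' (-s))) = f (P (-s))) ∧
      (∀ s ∈ Ioo 0 δ, ‖P (-s) - p - s • (-ξ)‖ ≤ R * s) ∧
      Tendsto (fun s => s⁻¹ • (P (-s) - p)) (𝓝[>] 0) (𝓝 (-ξ)) := by
    intro P P' hPd hPe hPc hPt
    refine ⟨fun s hs => ?_, fun s hs => ?_, fun s hs => ?_, ?_⟩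
    · have h := (hPd (-s) (hmem hs)).scomp s (hasDerivAt_neg s)
      simpa [Function.comp_def] using h
    · rw [← hPe (-s) (hmem hs), smul_neg, ← neg_smul, ← mul_neg]
    · have h := hPc (-s) (hmem hs)
      rw [abs_neg, abs_of_pos hs.1] at h
      simpa [smul_neg, neg_smul] using h
    · have h := (hPt.comp hneg).neg
      refine h.congr fun s => ?_
      simp only [Function.comp_apply, inv_neg, neg_smul, neg_neg]
  obtain ⟨h₁d', h₁e', h₁c', h₁t'⟩ := hrefl h₁d h₁e h₁c h₁t
  obtain ⟨h₂d', h₂e', h₂c', h₂t'⟩ := hrefl h₂d h₂e h₂c h₂t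
  have hEq := unstableCurve_unique_right (P₁ := fun σ => P₁ (-σ)) (P₂ := fun σ => P₂ (-σ))
    (P₁' := fun σ => -(P₁' (-σ))) (P₂' := fun σ => -(P₂' (-σ))) hlam hω hR hδρ' hf0 hfd hlip hAPr hexpA
    h₁d' h₂d' h₁e' h₂e' h₁c' h₂c' h₁t' h₂t'
  intro s hs
  have h := hEq (x := -s) ⟨by linarith [hs.2], by linarith [hs.1]⟩
  simpa using h

end Summit.NavierStokesRegularity.NavierStokesRegularity.Theorems.SkeletonJ1RUnstableCurve

end
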